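import Summits.CriticalPhenomena.PercolationContinuityZ3.Theorems.PercNearOneGluingNoHeavyPcintLoopExclusionLaw
import Summits.CriticalPhenomena.PercolationContinuityZ3.Theorems.PercNearOneGluingNoHeavyPcintNawMemoryTail
import Summits.CriticalPhenomena.PercolationContinuityZ3.Theorems.PercNearOneGluingNoHeavyPcintSiteClassCountLaw
import HarnessLib

/-!
# CriticalPhenomena/PercolationContinuityZ3 — Theorems/PercNearOneGluingNoHeavyPcintLoopExclusionSiteLaw.lean: the SITE TWIN of STRUCTURE CONJ C4 (loop exclusion for the neighbour-avoiding memory hierarchy), TYPED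

HONEST FRAMING: the neighbour-avoiding (site, B2) column's analogue of the typed law C4 of …PcintLoopExclusionLaw (bond, B1):
a numerical law with the same mechanism, pre-registered (P15, P15e′) and partly scored; NOT a theorem; not used by any
certified `p_c` cell.  Typed under the STANDING RULE «NUMERICS ⇒ STRUCTURE ⇒ CONJECTURE» (5) next to its bond twin.  Statement
of record: run/shared/lean/prim/pcint/STRUCTURE.md §2 (C4, 'SITE twin' row), §3 (P15, P15e′), §4 (N8); data
prim-pcint-2/gen15/c4site/site_first_order.{py,out}, gen16/P15-score.txt.

THE OBJECTS (over the tree's neighbour-avoidance-memory words, …PcintNawMemoryTail: `μ^N_τ(d) = nawMemGrowth d τ ↓ μ_NAW(ℤ^d)`,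
with the SHIFTED parity `μ^N_{2k} = μ^N_{2k−1}`, `nawMemGrowth_even_eq`):
* the rung cost **`Δ^N_τ(d) := ln(μ^N_{τ−2}/μ^N_τ)`** (`siteLoopCost`); at an even rung `τ = 2k` the constraint newly imposed is
  NON-ADJACENCY AT GAP `2k − 1` (`isNawMem_even_iff`: a coincidence at gap `2k` already forces an adjacency at gap `2k−1`);
* **`2τ p^N_τ(ℤ^d) = closingNawCount d τ`**: the `(τ−1)`-step words with neighbour-avoidance memory `τ − 2` (every pair of sites
  but the two ends distinct and, two or more steps apart, non-adjacent) whose END IS ADJACENT TO THE START — the oriented rooted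
  CHORDLESS neighbour-avoiding polygons of length `τ` opened at the root (the lane's `napcount.c` objects: `p^N_n(ℤ³) = 3, 4, 27, 246,
  2407, 25872, 295728` for n = 4..16; `p^N_n(ℤ⁶) = 15, 80, 3015, 129246, 6321815` for n = 4..12, kit j215057);
* the first-order density **`f^N_τ := 2τ p^N_τ · (1 + μ^N_{τ−2}) / (μ^N_{τ−2})^τ`** (`siteLoopDensity`; the lane's gen-15 convention:
  the adjacency-at-gap-(τ−1) density `2τp^N/μ^{τ−1}` plus the return-at-gap-τ density `2τp^N/μ^τ`), and the site COMPATIBILITY FACTOR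
  **`R^N_τ(d) := Δ^N_τ / f^N_τ`** (`siteLoopCompat`).

THE LAW (C4-site).  (a) `0 < R^N_τ(d) < 1` (`siteLoopCompatWindow`), (b) `R^N` strictly increasing in `d` (`siteLoopCompatStrictMonoDim`),
(c) strictly decreasing in `τ` (`siteLoopCompatStrictAntiMemory`), (d) for `d ≥ 5` `R^N_τ(d) → ρ^N_d ∈ (0,1)` (`siteLoopCompatLawHigh`; `α_d⁺ = 0`),
and the CROSS-COLUMN clause (e) **`R^N_τ(d) < R_τ(d)`** for `τ ≥ 6` (`siteLoopCompat_lt_loopCompat_conj`): avoiding ADJACENCY to the arms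
costs more than avoiding coincidence — the site hierarchy's loops are less compatible than the bond hierarchy's.  All clauses for
`d ≥ 3` (the lane's site column; `d = 2` untested).

PROVED HERE (kernel-checked, no `sorry`, standard axioms): `Δ^N_τ ≥ 0` (`siteLoopCost_nonneg`); the shifted parity
`Δ^N_{2k+1} = Δ^N_{2k+2}` (`siteLoopCost_odd_eq`, k ≥ 2); telescoping `Σ_{m<M} Δ^N_{2m+4} = ln μ^N_2 − ln μ^N_{2M+2}` (`sum_siteLoopCost`),
summability with sum `ln(μ^N_2/μ_NAW)` (`hasSum_siteLoopCost`, from `tendsto_nawMemGrowth`), and the link to the typed B2 memory-tail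
quantity **`nawLogRatio d (2M+2) = Σ_{m≥0} Δ^N_{2(m+M)+4}`** (`nawLogRatio_eq_tsum_siteLoopCost`); no chordless polygons of odd length
(`closingNawCount_odd`, parity: no adjacency at an even gap, `not_adj_wordPos_of_even`) and `closingNawCount d 4 > 0` for `d ≥ 2`
(`closingNawCount_four_pos`, the unit square).  NOT proved: `Δ^N_τ > 0` (strict monotonicity of the site hierarchy).

EVIDENCE LEDGER (`R^N_τ(d)`, even τ; gen15/c4site/site_first_order.out for d = 3, 4 on the lane's `μ^site_τ` (memmu site=1 = the tree's
`nawMemGrowth`, P14h-checked to 12 digits) and gen16/P15-score.txt for d = 6):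
 • `d = 3`, τ = 4..16: 0.720 0.349 0.320 0.270 0.244 0.227 0.214;   • `d = 4`, τ = 4..12: 0.797 0.479 0.398 0.363 0.340;
 • `d = 6`, τ = 4..12 (kit j215057, AFTER sealing P15): 0.869 0.631 0.555 0.520 0.502 (local exponents 0.79 / 0.45 / 0.29 / 0.19);
 • bond twins at the same cells (…PcintLoopExclusionLaw): d = 3: 0.715 0.593 0.529 0.489 0.460 0.437 0.419; d = 4: 0.780 0.692 0.647 0.617 0.596;
   d = 6: 0.848 0.792 0.769 0.757 0.749 — the site factor is the SMALLER one from τ = 6 on (at τ = 4 it is marginally larger: 0.720 vs 0.715,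
   0.797 vs 0.780, 0.869 vs 0.848, hence clause (e) starts at τ = 6).
PRE-REGISTERED: P15 (2026-08-24T07:38Z, predictions/P15-c4-site-twin-d456-2026-08-24.md sha256 1ff933dc…, sealed before kit j214741/j215057-60):
P15d `d = 6` τ-order HIT (0.631 > 0.555 > 0.520 > 0.502 = clause (c)); P15a/b (`R^N_14(4)`, `R^N_16(4)` bands), P15c (d-order 6 > 5 > 4 =
clause (b)) pending on kit j215058/j215060 at typing time; P15f fitted d-law bands MISS ×3 ⇒ N8 (about an interpolation formula in d, not
about (a)–(e)); P15e′ (08:40Z, sha256 58f0a6db…, two-term d-law bands for d = 5) pending.  Referee gen 106 re-derived the d = 6 column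
independently (own NAP counter).
SCOPE (honest): METHOD-side; nothing here is used by a certified cell.  Falsifiers: any `R^N ≥ 1` or `≤ 0`; an order inversion in d or τ;
`R^N_τ(d) ≥ R_τ(d)` at some τ ≥ 6.

Sources: N. Madras, G. Slade, The Self-Avoiding Walk (1993), §1.2 [MadrasSlade1993].  Written by prim-pcint-2 gen 16
(prover-prim-pcint-2-g16-0), 2026-08-24.
-/

noncomputable section

open Filter Topology
open Literature.Probability.LatticeModels Literature.Probability.Percolation
open Literature.Probability.RandomPlanarGeometry.SAW.Zd (connectiveConstant count)
open Summit.CriticalPhenomena.PercolationContinuityZ3.Theorems.Pcint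

namespace Summit.CriticalPhenomena.PercolationContinuityZ3.Theorems.Pcint.NawTail

variable {d : ℕ}

/-! ### A parity fact: no adjacency at an even gap -/

/-- **On the bipartite lattice two sites of a walk an EVEN number of steps apart are never lattice neighbours** (the `ℓ¹`-parity
of `ω(m)` is the parity of `m`, and a unit step flips it). [folklore] -/
theorem not_adj_wordPos_of_even {n : ℕ} (w : Fin n → Fin d × Bool) {i j : ℕ} (hi : i ≤ n) (hj : j ≤ n)
    (hij : (i + j) % 2 = 0) : ¬ (zdGraph d).Adj (wordPos w i) (wordPos w j) := by
  intro hadj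
  obtain ⟨a, ha⟩ := (zdGraph_adj_iff_stepVec _ _).1 hadj
  have hodd := l1_sub_stepVec_add_odd (wordPos w j) a
  rw [show wordPos w j - stepVec a = wordPos w i from by rw [ha, add_sub_cancel_right]] at hodd
  have hpi := MemoryTail.l1_wordPos_mod_two w i hi
  have hpj := MemoryTail.l1_wordPos_mod_two w j hj
  omega

/-! ### The objects -/

open Classical in
/-- **`2τ p^N_τ(ℤ^d)`**: the number of `(τ−1)`-step words with neighbour-avoidance memory `τ − 2` (all pairs of sites except the
two ends: distinct, and non-adjacent when two or more steps apart) whose end is ADJACENT to the start — oriented rooted chordless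
neighbour-avoiding polygons of length `τ` opened at the root (the lane's `napcount.c` count `NAPOPEN`). [folklore] -/
def closingNawCount (d τ : ℕ) : ℕ :=
  ((nawMemWords d (τ - 2) (τ - 1)).filter fun w => (zdGraph d).Adj 0 (wordPos w (τ - 1))).card

/-- **`Δ^N_τ(d) := ln(μ^N_{τ−2}(d)/μ^N_τ(d))`**, the rung cost of the neighbour-avoiding memory hierarchy. [folklore] -/
def siteLoopCost (d τ : ℕ) : ℝ := Real.log (nawMemGrowth d (τ - 2) / nawMemGrowth d τ)

/-- **`f^N_τ(d) := 2τ p^N_τ (1 + μ^N_{τ−2}) / (μ^N_{τ−2})^τ`**, the lane's first-order density for the site hierarchy (adjacency at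
gap `τ−1` plus return at gap `τ`; gen15/c4site/site_first_order.py).  STRUCTURE CONJ C4-site object. [folklore] -/
def siteLoopDensity (d τ : ℕ) : ℝ :=
  (closingNawCount d τ : ℝ) * (1 + nawMemGrowth d (τ - 2)) / nawMemGrowth d (τ - 2) ^ τ

/-- **`R^N_τ(d) := Δ^N_τ / f^N_τ`**, the site compatibility factor.  STRUCTURE CONJ C4-site object. [folklore] -/
def siteLoopCompat (d τ : ℕ) : ℝ := siteLoopCost d τ / siteLoopDensity d τ

/-! ### Proved bookkeeping -/

/-- `Δ^N_τ = ln μ^N_{τ−2} − ln μ^N_τ`. [folklore] -/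
theorem siteLoopCost_eq [NeZero d] (τ : ℕ) :
    siteLoopCost d τ = Real.log (nawMemGrowth d (τ - 2)) - Real.log (nawMemGrowth d τ) :=
  Real.log_div (nawMemGrowth_pos (τ - 2)).ne' (nawMemGrowth_pos τ).ne'

/-- **`Δ^N_τ(d) ≥ 0`** (`nawMemGrowth_antitone`). [folklore] -/
theorem siteLoopCost_nonneg [NeZero d] (τ : ℕ) : 0 ≤ siteLoopCost d τ :=
  Real.log_nonneg ((one_le_div (nawMemGrowth_pos τ)).2 (nawMemGrowth_antitone (by omega) d))

/-- **Shifted parity of the site rung costs: `Δ^N_{2k+1} = Δ^N_{2k+2}`** (`k ≥ 2`), from `μ^N_{2k} = μ^N_{2k−1}` and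
`μ^N_{2k+2} = μ^N_{2k+1}`. [folklore] -/
theorem siteLoopCost_odd_eq {k : ℕ} (hk : 2 ≤ k) (d : ℕ) : siteLoopCost d (2 * k + 1) = siteLoopCost d (2 * k + 2) := by
  unfold siteLoopCost
  have h1 : nawMemGrowth d (2 * k) = nawMemGrowth d (2 * k - 1) := nawMemGrowth_even_eq hk d
  have h2 : nawMemGrowth d (2 * k + 2) = nawMemGrowth d (2 * k + 1) := by
    have := nawMemGrowth_even_eq (k := k + 1) (by omega) d
    rwa [show 2 * (k + 1) = 2 * k + 2 by ring, show 2 * k + 2 - 1 = 2 * k + 1 by omega] at this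
  rw [show 2 * k + 1 - 2 = 2 * k - 1 by omega, show 2 * k + 2 - 2 = 2 * k by omega, h1, h2]

/-- `f^N_τ ≥ 0`. [folklore] -/
theorem siteLoopDensity_nonneg (d τ : ℕ) : 0 ≤ siteLoopDensity d τ :=
  div_nonneg (mul_nonneg (Nat.cast_nonneg _) (by linarith [nawMemGrowth_nonneg d (τ - 2)]))
    (pow_nonneg (nawMemGrowth_nonneg d _) _)

/-- `f^N_τ > 0` as soon as a chordless polygon of length `τ` exists. [folklore] -/
theorem siteLoopDensity_pos [NeZero d] {τ : ℕ} (h : 0 < closingNawCount d τ) : 0 < siteLoopDensity d τ :=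
  div_pos (mul_pos (by exact_mod_cast h) (by linarith [nawMemGrowth_pos (d := d) (τ - 2)]))
    (pow_pos (nawMemGrowth_pos _) _)

/-- `R^N_τ ≥ 0`. [folklore] -/
theorem siteLoopCompat_nonneg [NeZero d] (τ : ℕ) : 0 ≤ siteLoopCompat d τ :=
  div_nonneg (siteLoopCost_nonneg τ) (siteLoopDensity_nonneg d τ)

/-- **Telescoping**: `Σ_{m<M} Δ^N_{2m+4} = ln μ^N_2 − ln μ^N_{2M+2}`. [folklore] -/
theorem sum_siteLoopCost [NeZero d] (M : ℕ) :
    ∑ m ∈ Finset.range M, siteLoopCost d (2 * m + 4) =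
      Real.log (nawMemGrowth d 2) - Real.log (nawMemGrowth d (2 * M + 2)) := by
  induction M with
  | zero => simp
  | succ M ih =>
    rw [Finset.sum_range_succ, ih, siteLoopCost_eq, show 2 * M + 4 - 2 = 2 * M + 2 by omega,
      show 2 * (M + 1) + 2 = 2 * M + 4 by ring]
    ring

/-- The partial sums converge to `ln(μ^N_2/μ_NAW)` (`μ^N_τ → μ_NAW`, `tendsto_nawMemGrowth`). [folklore] -/
theorem tendsto_sum_siteLoopCost [NeZero d] :
    Tendsto (fun M : ℕ => ∑ m ∈ Finset.range M, siteLoopCost d (2 * m + 4)) atTop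
      (𝓝 (Real.log (nawMemGrowth d 2 / nawConst d))) := by
  have hμ := nawConst_pos (d := d)
  simp_rw [sum_siteLoopCost]
  rw [Real.log_div (nawMemGrowth_pos 2).ne' hμ.ne']
  have h2 : Tendsto (fun M : ℕ => 2 * M + 2) atTop atTop :=
    tendsto_atTop_atTop.2 fun b => ⟨b, fun a ha => by omega⟩
  exact tendsto_const_nhds.sub
    (((Real.continuousAt_log hμ.ne').tendsto).comp ((tendsto_nawMemGrowth (d := d)).comp h2))

/-- **Summability**: `Σ_{m≥0} Δ^N_{2m+4}(d) = ln(μ^N_2(d)/μ_NAW(ℤ^d))`. [folklore] -/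
theorem hasSum_siteLoopCost [NeZero d] :
    HasSum (fun m : ℕ => siteLoopCost d (2 * m + 4)) (Real.log (nawMemGrowth d 2 / nawConst d)) :=
  (hasSum_iff_tendsto_nat_of_nonneg (fun _ => siteLoopCost_nonneg _) _).2 tendsto_sum_siteLoopCost

/-- **The link to the typed B2 memory-tail quantity (PROVED)**: `ln(μ^N_{2M+2}/μ_NAW) = Σ_{m≥0} Δ^N_{2(m+M)+4}` — the site
memory-tail quantity `nawLogRatio` is the tail sum of the site rung costs. [folklore] -/
theorem nawLogRatio_eq_tsum_siteLoopCost [NeZero d] (M : ℕ) :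
    nawLogRatio d (2 * M + 2) = ∑' m : ℕ, siteLoopCost d (2 * (m + M) + 4) := by
  have hμ := nawConst_pos (d := d)
  have hs := hasSum_siteLoopCost (d := d)
  have h1 := hs.summable.sum_add_tsum_nat_add M
  rw [hs.tsum_eq, sum_siteLoopCost, Real.log_div (nawMemGrowth_pos 2).ne' hμ.ne'] at h1
  unfold nawLogRatio
  rw [Real.log_div (nawMemGrowth_pos _).ne' hμ.ne']
  linarith

/-! ### Closing words: parity and non-vacuity -/

/-- **No chordless polygons of odd length**: `closingNawCount d (2k+1) = 0` (the end of a `2k`-step word is never adjacent to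
its start). [folklore] -/
theorem closingNawCount_odd (d k : ℕ) : closingNawCount d (2 * k + 1) = 0 := by
  classical
  unfold closingNawCount
  rw [show 2 * k + 1 - 1 = 2 * k by omega, Finset.card_eq_zero, Finset.eq_empty_iff_forall_notMem]
  intro w hw
  rw [Finset.mem_filter] at hw
  have h := not_adj_wordPos_of_even w (i := 0) (j := 2 * k) (by omega) le_rfl (by omega)
  rw [wordPos_zero] at h
  exact h hw.2

/-- **`2·4·p^N_4(ℤ^d) > 0` for `d ≥ 2`**: the unit square is a chordless neighbour-avoiding polygon, so `f^N_4(d) > 0`.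
[folklore] -/
theorem closingNawCount_four_pos (hd : 2 ≤ d) : 0 < closingNawCount d 4 := by
  classical
  obtain ⟨w, hsaw, hl⟩ := MemoryTail.exists_closingWord_three hd
  unfold closingNawCount
  refine Finset.card_pos.2 ⟨w, ?_⟩
  show w ∈ (nawMemWords d 2 3).filter fun w => (zdGraph d).Adj 0 (wordPos w 3)
  rw [Finset.mem_filter, mem_nawMemWords]
  refine ⟨fun i j hj hij hτ => ⟨fun heq => absurd (hsaw i j (by omega) hj heq) (by omega), fun h2 => ?_⟩, ?_⟩
  · exact not_adj_wordPos_of_even w (by omega) hj (by omega)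
  · -- the end is at ℓ¹-distance exactly 1 from the origin, hence a unit step away
    have hne : wordPos w 3 ≠ 0 := fun h0 => by
      have := hsaw 3 0 le_rfl (by omega) (by rw [h0, wordPos_zero]); omega
    have hl1 : l1 (wordPos w 3) = 1 := by
      rcases Nat.lt_or_ge (l1 (wordPos w 3)) 1 with h | h
      · exfalso; apply hne; funext i
        have h0 : l1 (wordPos w 3) = 0 := by omega
        simp only [l1] at h0
        exact Int.natAbs_eq_zero.1 (Finset.sum_eq_zero_iff.1 h0 i (Finset.mem_univ _))
      · omega
    obtain ⟨a, ha⟩ := exists_eq_stepVec_of_l1_eq_one hl1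
    exact (zdGraph_adj_iff_stepVec _ _).2 ⟨a, by rw [ha, zero_add]⟩

/-- `f^N_4(d) > 0` for `d ≥ 2`. [folklore] -/
theorem siteLoopDensity_four_pos [NeZero d] (hd : 2 ≤ d) : 0 < siteLoopDensity d 4 :=
  siteLoopDensity_pos (closingNawCount_four_pos hd)

/-! ### The typed conjecture C4-site -/

/-- **C4-site (a), the WINDOW `0 < R^N_τ(d) < 1`** for `d ≥ 3` and even `τ = 2m ≥ 4`.  Evidence: every measured factor (d = 3, 4, 6;
τ = 4..16) lies in [0.21, 0.87].  STRUCTURE CONJ C4-site (prim-pcint-2 gen 15/16; not kernel-checked). -/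
@[conjecture] def siteLoopCompatWindow : Prop :=
  ∀ d : ℕ, 3 ≤ d → ∀ m : ℕ, 2 ≤ m → 0 < siteLoopCompat d (2 * m) ∧ siteLoopCompat d (2 * m) < 1

/-- **C4-site (b), MONOTONE IN THE DIMENSION**: `R^N_τ(d) < R^N_τ(d+1)`, `d ≥ 3`.  Evidence: d = 3 < 4 at τ = 4..12 and 4 < 6 at
τ = 4..12; pre-registered P15c (6 > 5 > 4) pending at typing.  STRUCTURE CONJ C4-site (not kernel-checked). -/
@[conjecture] def siteLoopCompatStrictMonoDim : Prop :=
  ∀ d : ℕ, 3 ≤ d → ∀ m : ℕ, 2 ≤ m → siteLoopCompat d (2 * m) < siteLoopCompat (d + 1) (2 * m)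

/-- **C4-site (c), MONOTONE IN THE MEMORY**: `R^N_{τ+2}(d) < R^N_τ(d)`, `d ≥ 3`.  Evidence: all measured columns strictly decreasing;
pre-registered P15d (`d = 6`: 0.631 > 0.555 > 0.520 > 0.502) HIT after sealing.  STRUCTURE CONJ C4-site (not kernel-checked). -/
@[conjecture] def siteLoopCompatStrictAntiMemory : Prop :=
  ∀ d : ℕ, 3 ≤ d → ∀ m : ℕ, 2 ≤ m → siteLoopCompat d (2 * m + 2) < siteLoopCompat d (2 * m)

/-- **C4-site (d), `d ≥ 5`: `R^N_τ(d) → ρ^N_d ∈ (0, 1)`** (`α_d⁺ = 0`, as for the bond twin).  Evidence: `d = 6` local exponents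
0.79 / 0.45 / 0.29 / 0.19 over τ = 4..12, flattening fast.  STRUCTURE CONJ C4-site (not kernel-checked). -/
@[conjecture] def siteLoopCompatLawHigh : Prop :=
  ∀ d : ℕ, 5 ≤ d → ∃ ρ : ℝ, 0 < ρ ∧ ρ < 1 ∧ Tendsto (fun m : ℕ => siteLoopCompat d (2 * m)) atTop (𝓝 ρ)

/-- **C4-site (e), the CROSS-COLUMN ORDER `R^N_τ(d) < R_τ(d)`** for `d ≥ 3` and even `τ = 2m ≥ 6`: avoiding ADJACENCY to the two arms
costs a chordless polygon more than avoiding coincidence costs a polygon — the site hierarchy's loops are the less compatible ones.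
Evidence: d = 3: 0.349 < 0.593, 0.320 < 0.529, 0.270 < 0.489, 0.244 < 0.460, 0.227 < 0.437, 0.214 < 0.419 (τ = 6..16); d = 4: 0.479 < 0.692,
0.398 < 0.647, 0.363 < 0.617, 0.340 < 0.596; d = 6: 0.631 < 0.792, 0.555 < 0.769, 0.520 < 0.757, 0.502 < 0.749; at τ = 4 the order is
REVERSED by a hair (0.720 > 0.715, 0.797 > 0.780, 0.869 > 0.848), whence `m ≥ 3`.  STRUCTURE CONJ C4-site (not kernel-checked). -/
@[conjecture] def siteLoopCompat_lt_loopCompat_conj : Prop :=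
  ∀ d : ℕ, 3 ≤ d → ∀ m : ℕ, 3 ≤ m → siteLoopCompat d (2 * m) < MemoryTail.loopCompat d (2 * m)

end Summit.CriticalPhenomena.PercolationContinuityZ3.Theorems.Pcint.NawTail
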